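import Summits.CriticalPhenomena.PercolationContinuityZ3.Theorems.PercNearOneGluingNoHeavyQuantLongTailPairHubRoute
import Summits.CriticalPhenomena.PercolationContinuityZ3.Theorems.PercNearOneGluingNoHeavyQuantShapeHubNarrow
import Summits.CriticalPhenomena.PercolationContinuityZ3.Theorems.PercNearOneGluingNoHeavyQuantShapeSibling
import HarnessLib

/-!
# QUANT lane R8, T-DEC: THE LONG-TAIL PAIR HUB — the width-2 sub-floor hub `S(γ₁) ∗ S(γ₂)` of EVERY shape `{lo, lo+K; γ}` with `2lo ≤ K ≤ 4lo` is SDEC at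
# EVERY gate `γᵢ ≥ lo/K` and every affordable floor, by ONE UNSPLIT TORQUE-COST ROUTE per outer gate (census-1 gen 32; the first long-tail hub of a
# small width in the kernel — g31/g32's near-route hubs need `lo·j > K`)

builds on p205010 (kernel theorem, internal audit signed; external expert review pending)

Support file (`--supports stmt-CriticalPhenomena-4575`), QUANT lane seat prim-quant-census-1 (gen 32); memo
`run/shared/lean/prim/quant/prim-quant-census-1/g32/TWOLO-G32.md` §3–§4.  Theorems only, standard axioms, no sorries.  Uses arm-1 g50's torque-cost
criterion `decAt_all_of_torqueCost` / g49's `decAt_all_of_lowCeiling`, g30/g31's route algebra (`pieceBlob_costA`, `cost_le_of_theta`, `rate_mul_le_of_theta`,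
`lconv_sp_apply`, `sHub_laws`, `sHub_struct`), the closed forms of `…QuantLongTailPairHubAlg` and the route `pairHubLong_route` (`…QuantLongTailPairHubRoute`).

THE LAW.  `sHub lo K [γ₁, γ₂] = S(γ₁) ∗ S(γ₂) = {2lo: (1−γ₁)(1−γ₂), 2lo+K: γ₁(1−γ₂)+γ₂(1−γ₁), 2lo+2K: γ₁γ₂}`, mean `T₀ = 2lo + K(γ₁+γ₂)`; the `|S| = 2` term of
the piece expansion of a forest of glued siblings `R^lo[qᵢ](R^K[gᵢ])`.  For `K > 2lo` the middle atom is far from the low `2lo` for `T ≤ 2lo+K` and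
incompatible for `T ≥ 4lo+K`, so near routes (g31 `sdec_farthestNear`, g32 `sdec_sHub_two`) do not exist: this is the smallest instance of the "small
widths `lo·j ≤ K`" blocker of every long-tail forest theorem (memo §3).
* THE CERTIFICATE (`pairHubLong_route`, `…QuantLongTailPairHubRoute`) per outer gate `a` (`T = aT₀ > 4lo`, `y = ax`): ship the low `2lo` ENTIRELY to the middle atom while its
  credit capacity lasts, `(T−4lo)·(u₀+u₁) ≤ K·u₁` (i.e. `T ≤ τ = 4lo + K·u₁/(u₀+u₁)`; compatible since then `T < 4lo+K`; floor capacity `y ≤ x ≤ u₁/(u₀+u₁)`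
  always, `ltPair_capMid`; torque cost only for `T < 2lo+K`, paid from the low's own lever since `max(y,ρ)·K ≤ T−2lo`), and ENTIRELY to the top afterwards
  (credit capacity `ltPair_capRho`, unconditional; floor capacity `ltPair_capTop` — exhausted middle credit forces `γ₂(2Kγ₁+lo) > lo+Kγ₁`; the switch happens
  above the middle atom, `ltPair_above`, so the budget has the two levers `u₀(T−2lo) + u₁(T−2lo−K)`; the cost with `θ = ρ` is the low's own lever, the cost
  with `θ = y` is a CONCAVE quadratic in `T` on `[τ, T₀]`, nonnegative at `T₀` by the top's floor capacity and the torque identity, and at `τ` by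
  `ltPair_cost0` — `quad_concave_between`).
* **`sdec_sHub_two_long`** — `lo < K`, `2lo ≤ K ≤ 4lo`; `P = [γ₁, γ₂]` with `lo ≤ Kγᵢ`, `γᵢ < 1`, `x(lo+K) ≤ lo+Kγᵢ`; `0 < x` ⟹
  **`SDEC x ((lo+K)·2) (sHub lo K P)`**; **`sdec_sHub_two_all`** — with g32's `sdec_sHub_two` (`K ≤ 2lo`): the width-2 hub of EVERY shape `lo < K ≤ 4lo`
  is SDEC at every gate and every affordable floor.
NUMERICS (memo §1/§3, code/exp23–exp28, exact rationals): the rule certifies every (hub, gate) instance for `K ≤ 4.5lo` (0 failures on 13 shapes ×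
14-point asymmetric grids × 48 gates, fine symmetric scans 8 000–11 000 instances per shape); single routes FAIL from `K = 5lo` (thin window `γ ≈ 0.55`,
`a ≈ 1`; the symmetric threshold is `lo/K = 0.2113`, the crossing of `o²/((1+o)(1+2o))` and `o(o−1)/(1+o)` at odds `o = (1+√3)/2`), where split routes are
needed — so `K ≤ 4lo` is near the natural range of this certificate.

HONEST STATUS.  A core lemma (width 2 only); widths `3 ≤ j ≤ K/lo`, the piece beside a blob for `K > 2lo`, and gates below `1/2` at widths `≥ 4` remain
the blockers of long-tail forest theorems (memo §3); `SiblingStep`, `GluedDominatedMass`, `SDECConvClosed`, `FarTreeRow` OPEN; RATE class (log\*) / honest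
sentence of `run/shared/lean/prim/quant/README.md` unchanged.  [this work].  Nothing here is cited as a published result.  The gluing rows served
[cite: KozmaNitzan2024, Conjecture 3 (p. 15)]; product measure [cite: Grimmett1999, §1.3 p. 10].
-/

noncomputable section

open scoped BigOperators

namespace Summit.CriticalPhenomena.PercolationContinuityZ3.Theorems
namespace Quant
namespace LawDec

open Finset

/-- the FAR-GIANT PIECE of shape `(lo, K)`: `S(γ) = {lo: 1−γ, lo+K: γ}` -/
local notation3 "SP[" lo ", " K ", " a "]" => (fun h : ℕ => (1 - (a : ℝ)) * (if h = (lo : ℕ) then (1 : ℝ) else 0) +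
  (a : ℝ) * (if h = (lo : ℕ) + (K : ℕ) then (1 : ℝ) else 0))

/-! ### The long-tail pair hub is SDEC -/

/-- **THE LONG-TAIL PAIR HUB IS SDEC.**  For `lo < K`, `2lo ≤ K ≤ 4lo`, a pair of gates `P = [γ₁, γ₂]` with `lo ≤ Kγᵢ` (far-giant pieces), `γᵢ < 1`,
`x(lo+K) ≤ lo + Kγᵢ` (affordable), and every floor `0 < x`: `SDEC x ((lo+K)·|P|) (sHub lo K P)`. [this work] -/
theorem sdec_sHub_two_long (lo K : ℕ) (hloK : lo < K) (hK2 : 2 * lo ≤ K) (hK4 : K ≤ 4 * lo) {x : ℝ} (hx0 : 0 < x) (P : List ℝ)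
    (hP2 : P.length = 2) (hP : ∀ γ ∈ P, (lo : ℝ) ≤ K * γ ∧ γ < 1 ∧ x * ((lo : ℝ) + K) ≤ lo + K * γ) :
    SDEC x ((lo + K) * P.length) (sHub lo K P) := by
  obtain ⟨γ₁, γ₂, rfl⟩ := List.length_eq_two.1 hP2
  obtain ⟨hγ₁, hγ₁1, hx₁⟩ := hP γ₁ (by simp)
  obtain ⟨hγ₂, hγ₂1, hx₂⟩ := hP γ₂ (by simp)
  have hlo1 : 1 ≤ lo := by omega
  have hloR : (1 : ℝ) ≤ lo := by exact_mod_cast hlo1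
  have hKR : (lo : ℝ) < K := by exact_mod_cast hloK
  have hK0 : (0 : ℝ) < K := by linarith
  have hγ₁0 : 0 ≤ γ₁ := by
    by_contra hc; push Not at hc; have := mul_neg_of_pos_of_neg hK0 hc; linarith
  have hγ₂0 : 0 ≤ γ₂ := by
    by_contra hc; push Not at hc; have := mul_neg_of_pos_of_neg hK0 hc; linarith
  have hx1 : x < 1 := by
    have : (lo : ℝ) + K * γ₁ < lo + K := by have := mul_lt_mul_of_pos_left hγ₁1 hK0; linarith
    by_contra hc; push Not at hc
    have : 1 * ((lo : ℝ) + K) ≤ x * (lo + K) := mul_le_mul_of_nonneg_right hc (by linarith)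
    linarith
  -- the law and its three atoms
  have hP01 : ∀ γ ∈ [γ₁, γ₂], 0 ≤ γ ∧ γ ≤ 1 := by
    intro γ hγ; simp only [List.mem_cons, List.mem_nil_iff, or_false] at hγ
    rcases hγ with rfl | rfl
    · exact ⟨hγ₁0, hγ₁1.le⟩
    · exact ⟨hγ₂0, hγ₂1.le⟩
  obtain ⟨l0, lM, l1, lmean⟩ := sHub_laws lo K [γ₁, γ₂] hP01
  have eT0 : (([γ₁, γ₂] : List ℝ).map (fun γ => (lo : ℝ) + K * γ)).sum = 2 * (lo : ℝ) + K * (γ₁ + γ₂) := by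
    simp only [List.map_cons, List.map_nil, List.sum_cons, List.sum_nil]; ring
  rw [eT0] at lmean
  have elen : (lo + K) * ([γ₁, γ₂] : List ℝ).length = 2 * lo + 2 * K := by show (lo + K) * 2 = 2 * lo + 2 * K; ring
  rw [elen] at lM l1 lmean ⊢
  set L : ℕ → ℝ := sHub lo K [γ₁, γ₂] with hL
  -- explicit values
  have cM : ∀ i, (lo + K) * 1 < i → SP[lo, K, γ₂] i = 0 := fun i hi => (sp_laws lo K hγ₂0 hγ₂1.le).2.1 i (by omega)
  have hS2 : sHub lo K [γ₂] = SP[lo, K, γ₂] := funext fun k => lconv_delta_left _ (lo + K) _ (sp_laws lo K hγ₂0 hγ₂1.le).2.1 k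
  have hdef : L = lconv ((lo + K) * 1) (lo + K) SP[lo, K, γ₂] SP[lo, K, γ₁] := by
    rw [hL]; show lconv _ _ (sHub lo K [γ₂]) _ = _; rw [hS2]; rfl
  have Lv : ∀ k, L k = (1 - γ₁) * (if lo ≤ k then SP[lo, K, γ₂] (k - lo) else 0) + γ₁ * (if lo + K ≤ k then SP[lo, K, γ₂] (k - (lo + K)) else 0) :=
    fun k => by rw [hdef]; exact lconv_sp_apply lo K ((lo + K) * 1) SP[lo, K, γ₂] γ₁ cM k
  have vlo : L (2 * lo) = (1 - γ₁) * (1 - γ₂) := by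
    rw [Lv, if_pos (by omega), if_neg (by omega), show 2 * lo - lo = lo by omega]
    dsimp only; rw [if_pos rfl, if_neg (by omega)]; ring
  have vmid : L (2 * lo + K) = γ₁ * (1 - γ₂) + γ₂ * (1 - γ₁) := by
    rw [Lv, if_pos (by omega), if_pos (by omega), show 2 * lo + K - lo = lo + K by omega, show 2 * lo + K - (lo + K) = lo by omega]
    dsimp only; rw [if_neg (by omega), if_pos rfl, if_pos rfl, if_neg (by omega)]; ring
  have vtop : L (2 * lo + 2 * K) = γ₁ * γ₂ := by
    rw [Lv, if_pos (by omega), if_pos (by omega), show 2 * lo + 2 * K - lo = lo + 2 * K by omega,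
      show 2 * lo + 2 * K - (lo + K) = lo + K by omega]
    dsimp only; rw [if_neg (by omega), if_neg (by omega), if_neg (by omega), if_pos rfl]; ring
  -- support: charged atoms are `2lo + Ks`
  have hsupp : ∀ k, L k ≠ 0 → ∃ s, k = lo * 2 + K * s ∧ s ≤ 2 := by
    intro k hk
    have := (sHub_struct lo K hloK 0 le_rfl [γ₁, γ₂] (fun γ hγ => ⟨(hP01 γ hγ).1, (hP01 γ hγ).2, by
      rw [zero_mul]; exact (hP01 γ hγ).1⟩)).1 k hk
    simpa using this
  clear_value L
  intro a ha0 ha1 j' hj'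
  obtain ⟨g0, gM, g1⟩ := gate_laws (2 * lo + 2 * K) L a ha0.le ha1 l0 lM l1
  have gmean : ∑ h ∈ Finset.range (2 * lo + 2 * K + 1), (h : ℝ) * gate L a h = a * (2 * (lo : ℝ) + K * (γ₁ + γ₂)) := by
    rw [sum_mul_gate, lmean]
  have gv : ∀ h, h ≠ 0 → gate L a h = a * L h := fun h hh => by rw [gate_apply, if_neg hh, mul_zero, add_zero]
  set T : ℝ := a * (2 * (lo : ℝ) + K * (γ₁ + γ₂)) with hT
  have hax0 : 0 < a * x := mul_pos ha0 hx0
  have hax1 : a * x < 1 := by have := mul_le_mul_of_nonneg_right ha1 hx0.le; linarith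
  have hT0p : 0 < 2 * (lo : ℝ) + K * (γ₁ + γ₂) := by
    have := mul_nonneg hK0.le (add_nonneg hγ₁0 hγ₂0); linarith
  have hT0 : 0 < T := mul_pos ha0 hT0p
  have hTle : T ≤ 2 * (lo : ℝ) + K * (γ₁ + γ₂) := by
    have := mul_le_mul_of_nonneg_right ha1 hT0p.le; rw [hT]; linarith
  have hta : a * x * ((2 * lo + 2 * K : ℕ) : ℝ) ≤ T := by
    have h2 : x * (2 * (lo : ℝ) + 2 * K) ≤ 2 * (lo : ℝ) + K * (γ₁ + γ₂) := by linarith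
    have h3 := mul_le_mul_of_nonneg_left h2 ha0.le
    push_cast; rw [hT]; linarith
  -- a charged low is the bottom atom `2lo`
  have lowatom : ∀ l : ℕ, 1 ≤ l → 2 * (l : ℝ) < T → 0 < gate L a l → l = 2 * lo := by
    intro l hl hlT hpos
    have hLl : L l ≠ 0 := by
      intro h0; rw [gv l (by omega), h0, mul_zero] at hpos; exact lt_irrefl _ hpos
    obtain ⟨s, hs, _⟩ := hsupp l hLl
    rcases Nat.eq_zero_or_pos s with h0 | hs1
    · rw [hs, h0]; ring
    · exfalso
      have h1 : (K : ℝ) * 1 ≤ K * s := mul_le_mul_of_nonneg_left (by exact_mod_cast hs1) hK0.le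
      have hl' : (l : ℝ) = lo * 2 + K * s := by rw [hs]; push_cast; ring
      have : (K : ℝ) * (γ₁ + γ₂) < K * 2 := mul_lt_mul_of_pos_left (by linarith) hK0
      linarith
  by_cases hT4 : 4 * (lo : ℝ) < T
  · -- one positive low: the route
    have v0 : gate L a (2 * lo) = a * ((1 - γ₁) * (1 - γ₂)) := by rw [gv _ (by omega), vlo]
    have v1 : gate L a (2 * lo + K) = a * (γ₁ * (1 - γ₂) + γ₂ * (1 - γ₁)) := by rw [gv _ (by omega), vmid]
    have v2 : gate L a (2 * lo + 2 * K) = a * (γ₁ * γ₂) := by rw [gv _ (by omega), vtop]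
    -- order the gates
    obtain ⟨t, ht, hTt, hcapt, hcostt⟩ : ∃ t : ℕ, (t = 2 * lo + K ∨ t = 2 * lo + 2 * K) ∧ (T < ((2 * lo : ℕ) : ℝ) + (t : ℝ)) ∧
        freeRate (a * x) T (2 * lo) t * gate L a (2 * lo) ≤ gate L a t ∧
        (if T < (t : ℝ) then ((t : ℝ) - T) * (freeRate (a * x) T (2 * lo) t * gate L a (2 * lo)) else 0)
          ≤ ∑ l ∈ Finset.range (2 * lo + 2 * K + 1), (if (1 ≤ l ∧ (l : ℝ) < T) then gate L a l * (T - l) else 0) := by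
      rcases le_total γ₁ γ₂ with hle | hle
      · exact pairHubLong_route lo K hloK hK2 hK4 (gate L a) (a * x) T a γ₁ γ₂ x g0 hle hγ₁ hγ₂1 hx0 hx₁ ha0 ha1 rfl
          (by rw [hT]) hT4 v0 (by rw [v1]) v2
      · exact pairHubLong_route lo K hloK hK2 hK4 (gate L a) (a * x) T a γ₂ γ₁ x g0 hle hγ₂ hγ₁1 hx0 hx₂ ha0 ha1 rfl
          (by rw [hT]; ring) hT4 (by rw [v0]; ring) (by rw [v1]; ring) (by rw [v2]; ring)
    have httop : t ≤ 2 * lo + 2 * K := by rcases ht with rfl | rfl <;> omega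
    have htmem : t ∈ Finset.range (2 * lo + 2 * K + 1) := Finset.mem_range.2 (by omega)
    have htlo : 2 * lo < t := by rcases ht with rfl | rfl <;> omega
    have rowlo : ∑ h ∈ Finset.range (2 * lo + 2 * K + 1), (if 2 * lo = 2 * lo ∧ h = t then gate L a (2 * lo) else 0)
        = gate L a (2 * lo) := by
      rw [Finset.sum_eq_single_of_mem t htmem (fun h _ hh => by simp [hh])]
      simp
    have rowz : ∀ l : ℕ, l ≠ 2 * lo →
        ∑ h ∈ Finset.range (2 * lo + 2 * K + 1), (if l = 2 * lo ∧ h = t then gate L a (2 * lo) else 0) = 0 := by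
      intro l hl; exact Finset.sum_eq_zero fun h _ => by simp [hl]
    have colt : ∑ l ∈ Finset.range (2 * lo + 2 * K + 1), freeRate (a * x) T l t * (if l = 2 * lo ∧ t = t then gate L a (2 * lo) else 0)
        = freeRate (a * x) T (2 * lo) t * gate L a (2 * lo) := by
      rw [Finset.sum_eq_single_of_mem (2 * lo) (Finset.mem_range.2 (by omega)) (fun l _ hl => by simp [hl])]
      simp
    have colz : ∀ h : ℕ, h ≠ t →
        ∑ l ∈ Finset.range (2 * lo + 2 * K + 1), freeRate (a * x) T l h * (if l = 2 * lo ∧ h = t then gate L a (2 * lo) else 0) = 0 := by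
      intro h hh; exact Finset.sum_eq_zero fun l _ => by simp [hh]
    have c2lo : ((2 * lo : ℕ) : ℝ) = 2 * (lo : ℝ) := by push_cast; ring
    refine decAt_all_of_torqueCost (a * x) (2 * lo + 2 * K) (gate L a) T
      (fun l h => if l = 2 * lo ∧ h = t then gate L a (2 * lo) else 0) hax0 hax1 g0 gM g1 gmean hT0 hta ?_ ?_ ?_ ?_ ?_ j' hj'
    · intro l h; split_ifs
      · exact g0 _
      · exact le_rfl
    · intro l h hlh
      split_ifs at hlh with hc
      · obtain ⟨rfl, rfl⟩ := hc
        exact ⟨by omega, by rw [c2lo]; linarith, htlo, httop, hTt⟩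
      · exact absurd hlh (lt_irrefl _)
    · intro l hl hlow
      by_cases hl' : l = 2 * lo
      · subst hl'; exact rowlo
      · rw [rowz l hl']
        rcases (g0 l).eq_or_lt with h0 | hpos
        · exact h0
        · exact absurd (lowatom l hl hlow hpos) hl'
    · intro h _
      by_cases hh : h = t
      · subst hh; rw [colt]; exact hcapt
      · rw [colz h hh]; exact g0 h
    · rw [Finset.sum_eq_single_of_mem t htmem (fun h _ hh => by rw [colz h hh, mul_zero, ite_self])]
      rw [colt]
      exact hcostt
  · -- no positive low atom
    refine decAt_all_of_lowCeiling (a * x) (2 * lo + 2 * K) (gate L a) T hax0 hax1 g0 gM g1 gmean hT0 hta ?_ j' hj'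
    intro l hl hlow hpos
    exfalso
    have h2 := lowatom l hl hlow hpos
    subst h2
    push_cast at hlow
    exact hT4 (by linarith)

/-- **THE WIDTH-2 HUB OF EVERY SHAPE `lo < K ≤ 4lo` IS SDEC** at every gate `γᵢ ≥ lo/K` and every affordable floor (`sdec_sHub_two` for `K ≤ 2lo` by a near
route, `sdec_sHub_two_long` for `2lo ≤ K ≤ 4lo` by a torque-cost route). [this work] -/
theorem sdec_sHub_two_all (lo K : ℕ) (hloK : lo < K) (hK4 : K ≤ 4 * lo) {x : ℝ} (hx0 : 0 < x) (P : List ℝ) (hP2 : P.length = 2)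
    (hP : ∀ γ ∈ P, (lo : ℝ) ≤ K * γ ∧ γ < 1 ∧ x * ((lo : ℝ) + K) ≤ lo + K * γ) :
    SDEC x ((lo + K) * P.length) (sHub lo K P) := by
  rcases le_or_gt K (2 * lo) with h | h
  · exact sdec_sHub_two lo K hloK h hx0 P hP2 hP
  · exact sdec_sHub_two_long lo K hloK h.le hK4 hx0 P hP2 hP

end LawDec
end Quant
end Summit.CriticalPhenomena.PercolationContinuityZ3.Theorems
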